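import Literature.AlgebraicGeometry.HodgeTheory.WeilFamilyReachSimilar
import Literature.AlgebraicGeometry.HodgeTheory.BlochSemiregularSpreadCells
import Literature.AlgebraicGeometry.HodgeTheory.WeilTypePeriodPoint
import Literature.AlgebraicGeometry.HodgeTheory.HodgeTypeConjugation
import HarnessLib

/-!
# Bloch seeds at Weil anchors: a Bloch-semiregular integral local complete intersection carrying `q·hⁿ + w`
# feeds the local clause of the Weil ladder (Bloch 1972 / Buchweitz–Flenner 2003, class-level form in the tree)

Family `hodge`, layer `Literature/AlgebraicGeometry/HodgeTheory`. Requested by the B2b ladder `hodge-weil` (packet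
`run/shared/lean/b2b/hodge-weil/`, seat prover 2 generation 4, variational chair). PREDICATES (real definitions) and
PROVED bridges; NOTHING is asserted. The three "doors" of the packet's `LADDER.md ## CARVER v4 C30` reduce the open rungs
of Weil's question for `K = ℚ(√-d)` to ONE un-printed LOCAL input each — `HasLocallyAlgebraicWeilAnchor n d` (door A,
hyperbolic anchors; `WeilClassesLocalAnchor.lean`), `HasSimilarLocallyAlgebraicWeilAnchorsAwayFromSplit 3 d` (door B′,
Weil-similar anchors; `WeilFamilyReachSimilar.lean`), `HasLocallyAlgebraicTensorAnchors k p` (door T) — i.e. to the local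
clause `WeilAnchorLocalClause n d P h w` (`WeilClassesAnchorEngine.lean`): "`q·Hⁿ + W` is algebraic on the fibres over an
open neighbourhood of the anchor". The two object-level feeders of that clause typed so far rest on UNREFEREED inputs
(Markman 2025, `Markman2025_secantAnchor_locallyAlgebraic_sixfold`; Perry 2026, `Perry2026_semiregularTwisted_remainsAlgebraic`
via `hasLocallyAlgebraicWeilAnchor_of_perryTwisted_kappaAnchorObject`). This file types the feeder whose deformation
theory is REFEREED and already rendered in the tree on real carriers: Bloch's semiregularity theorem for local complete
intersections in its class-level form `BlochSemiregularSpread n p` (`BlochSemiregularSpread.lean`: Bloch 1972 Thm. (7.4)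
and Remark (7.5); Buchweitz–Flenner 2003 Thm. 5.2 at `I = {p}`; Voisin, LNM 1594, Lecture 7, Thm. 2.4), with Bloch
semiregularity `IsBlochSemiregular` (`BlochSemiregularityMapReal.lean`) and local complete intersections
`IsRegularImmersionOfCodim` as real predicates.

* `HasBlochSeedAt n P h w` (PREDICATE): on the abelian variety `P` (intended `dim P = 2n`) there are an INTEGRAL closed
  subscheme `i : Z ↪ P` which is a regular immersion of codimension `n` (local complete intersection of pure
  codimension `n`), Bloch-semiregular in `P` (`IsBlochSemiregular i (2n) n`: injectivity of
  `π : H¹(Z, 𝒩) → H^{n+1}(P, Ω^{n-1})`), and `q ∈ ℚ` such that the class `q·hⁿ + w` is SUPPORTED on `Z` (hence, by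
  purity, a multiple of `cl(Z)`). Bloch, Remark (7.5): "The hypothesis on `z₀` in (7.4) can be weakened to read: there
  exist integers `a, b`, `a ≠ 0`, such that `a z₀ + b l₀^p` is the class of a subscheme `Z₀ ⊂ X₀` which is semi-regular
  and a local complete intersection" — `HasBlochSeedAt` is literally that hypothesis for `z₀ = w`, `l₀ = h`.
* `weilAnchorLocalClause_of_blochSpread_of_blochSeedAt` (PROVED): `BlochSemiregularSpread (2n) n → HasBlochSeedAt n P h w →
  WeilAnchorLocalClause n d P h w` for every `d` — along any family of the clause the global class `q·Hⁿ + W` is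
  fibrewise rational of type `(n,n)` (cup powers of rational `(1,1)` classes) and restricts to `q·hⁿ + w` at the chart,
  so the class-level Bloch theorem gives the open neighbourhood.
* `HasHyperbolicBlochSeed n d`, `hasLocallyAlgebraicWeilAnchor_of_blochSpread_of_hyperbolicBlochSeed` (door A: a seed on
  ONE hyperbolic anchor gives `HasLocallyAlgebraicWeilAnchor n d`); `HasSimilarBlochSeeds n d`,
  `HasSimilarBlochSeedsAwayFromSplit n d` and the bridges to `HasSimilarLocallyAlgebraicWeilAnchors(AwayFromSplit) n d`
  (door B′: a seed on a Weil-similar anchor of every (non-hyperbolic) target).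

## What a seed may NOT be (design-space census; results of this project, pointers only — nothing here is used in a proof)

Bloch (7.5): "The problem of constructing semi-regular representatives for algebraic cycle classes of codimension `> 1`
remains, however, wide open." In the Weil setting the tree's crux seats have EXCLUDED the naive seed classes; a seed
witnessing `HasBlochSeedAt` at a CM / tensor / product anchor must avoid all of them:
(1) a single translated abelian subvariety `B ⊂ P`: never for `n ≥ 2` (for `n = 1` the Weil classes of a Weil-type
abelian surface are divisor classes and sub-elliptic curves DO represent `q·h + w`) — `[B]·pr^*θ' = 0` for the
complementary factor and the
PRIMITIVITY of the Weil plane (`h ⌣ w = 0` for every `K`-symmetric `h`, i.e. `φ^*h = d·h`: KERNEL-CHECKED as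
`cupProduct_eq_zero_of_map_eq_smul_of_mem_weilClassesOf`, file `WeilClassesPolarizationOrthogonal.lean`, this seat)
force `q = 0` (via `w ⌣ h^{n-1} = 0`, `n - 1 ≥ 1`), and then `w² ≠ 0` (Hodge–Riemann on the Weil plane) contradicts `[B]² = 0` (packet
`b2b-hweil-pv2-g4/BLOCH-SEEDS.md` §2; a single subtorus IS Bloch-semiregular, which is why only its class fails);
(2) galleries / unions of translated subtori with normal crossings (the only lci unions): never, in every dimension
`2n ≥ 4` — the ISOTROPY NO-GO (`Summits/…/Cruxes/HodgeAbelianVarieties/Lines/subtorus-gallery-bloch-seeds-dead.md` and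
`-dead-a2.md`: a positive combination of pairwise non-transversal half-dimensional subtorus classes is a PSD form of
rank `≥ C(2n,n) − 2` on an isotropic span of dimension `≤ C(2n,n)/2`; not even `θⁿ` is reached);
(3) disconnected seeds and direct sums: never, by the interaction principle (obstructions of the components are
independent and individually non-zero along a Weil direction while `π` of their sum vanishes; card
`Cruxes/HodgeAbelianVarieties/Ideas/subtorus-gallery-bloch-seeds.md` (I1)–(I3), `Cruxes/WeilSixfolds/STRATEGY-CENSUS.md` T2 (ii)) —
whence the predicate asks for `Z` INTEGRAL, as `BlochSemiregularSpread` does;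
(4) complete intersections of ample divisors: never in dimension `2n ≥ 4` — "a CI remembers its divisors": `H²(𝒪_P) ↪
H¹(𝒪_Z(D_j))` makes the obstruction along a Weil direction non-zero while `π` kills it, so `π` has kernel
(`Cruxes/HodgeAbelianVarieties/BarrierNotesIdeator4Round2.md` B3, correcting the count of card
`semiregular-ci-at-product-anchors`); at the generic tensor point `A₀ ⊗ ℤ[√-d]` (`A₀` a general ppav of dimension 3) a
divisor CI does not even have the right CLASS: `B³(A₀²) ≅ Sym³(NS_ℚ)`, `NS_ℚ = ⟨θ₁, θ₂, P⟩` (skew Howe duality for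
the pair `(Sp(H¹(A₀)), GL₂)`, the branching rule "`S_λ(H)^{Sp} ≠ 0` iff all columns of `λ` are even", and the first
fundamental theorem for `Sp` — the invariants are generated in degree 2 —, with the independence of the ten cubic
monomials checked exactly in `BLOCH-SEEDS.md` §3 / `tensor_point_cubic.py`) and `q·h³ + w = q·N³ + a·L³ + ā·L̄³` is a
smooth Fermat plane cubic for `q·a ≠ 0`, hence not a product of linear forms (`BLOCH-SEEDS.md` §3; found
independently as "H2 (ii)" by lead c12 of crux 1260); nor at the `ζ₃`-symmetric type-II QM points of
`ℚ(√-3)`-components — ERRATUM (the earlier clause here, after card B3's "positive by-product", asserted that smooth CI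
threefolds with class exactly in `ℚθ³ ⊕ W` DO exist there and are rigid; that is FALSE): the triple intersection of the
`ζ₃`-rotates of a divisor `bθ + a·x² + ā·y²` has class `b³θ³ − 3b·aā·θx²y² + a³x⁶ + ā³y⁶`, and the parasitic term
`−3b·aā·θ·x²·y²` does not lie in `ℚθ³ ⊕ W` (packet `b2b-hweil-pv1-g57/NSC-SEEDS-1.md` §3.4, LEMMA 7 and ERRATUM-B3: 42
inconsistent coordinates on all five test rows; kernel `Summits/…/Theorems/WeilTypeLadderNscSeedsOne.nsc1_norm_form_cubic`;
referee R925 (d) CONFIRMED, correction licensed C806 (δ) / C810 (β)), so no divisor CI has class exactly in `ℚθ³ ⊕ W`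
there either;
(5) ample corank-one determinantal designs at a tensor point: the degeneracy locus `Z = D_{f−1}(φ)` of a general map
`φ : F → E` of split bundles with `Hom(F, E)` ample, `rk E − rk F = 2`, on `Y₀ = A₀ ⊗ ℤ[√-d]` (`A₀` a very general ppav
threefold; a member of the split cell `(3, d, [−1])`) — "a degeneracy locus remembers its canonical class": six
Lefschetz steps on `Z̃ ⊂ ℙ(F)` force `i_*K_Z = 2c₄(E−F) + c₁c₃ ∈ ℚN⁴` (and two degree-10 conditions) for any `Z`
deforming along the Weil family, which kills all eight certified class-test-passing paired designs
(`WeilClassTestCanonicalObstruction.lean`, exact obstruction numbers) and, granted the cell's Conjecture N (real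
algebra; PROVED in format (4,2), on all null-cone configurations, and on the `k ≤ 2` strata of format (5,3) up to two
boundary exits; OPEN in general), every pure pairwise-ample such design in every format; the same degree-8 condition
kills the Γ-symmetric degeneracy loci of THEOREM DL at the CM point `E⁶` (packet C815). Pointers:
`b2b-hweil-pv2-g7/SEED-OBSTRUCTION.md` §§3, 9; `MODEL-SCOPE.md`; `b2b-hweil-pv2-g33/DOOR-A-CENSUS.md` §5 (wording ENDORSED
by referee R937 (e); inserted by prover 2 generation 35 under carver C835 (e), docstring only).
What survives: integral local complete intersections that "forget their constituents" (B3's phrase) — smoothings,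
linked residuals, degeneracy loci that are lci, … — for which Bloch-semiregularity is a genuine cohomological
computation; no instance is known (Bloch (7.5)). The predicate is therefore an honest DESIGN INPUT: it is NOT implied by
the Hodge conjecture (no on-path lemma is claimed for it), unlike the class-level local predicates it feeds.

## References

* [Bloch1972Semiregularity] S. Bloch, Semi-regularity and de Rham cohomology, Invent. Math. 17 (1972) 51–66: Thm.
  (7.4) and Remark (7.5) (quoted above; full quotations in `BlochSemiregularityTheorem.lean`).
* [BuchweitzFlenner2003] R.-O. Buchweitz, H. Flenner, A semiregularity map for modules and applications to
  deformations, Compositio Math. 137 (2003) 135–210, Thm. 5.2, (8.1), Prop. 8.2.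
* [VoisinTorino1994] C. Voisin, Transcendental methods in the study of algebraic cycles, LNM 1594, Lecture 7, Thm. 2.4.
* [Deligne1982HodgeCycles] P. Deligne, Hodge cycles on abelian varieties, LNM 900 (1982), proof of Thm. 4.8 (the Weil
  families the local clause is evaluated along).
* [Markman2025SecantWeil] E. Markman, arXiv:2502.03415 (UNREFEREED), §1.5 (the shape `q·hⁿ + w` of an anchor class).
-/

noncomputable section

open CategoryTheory AlgebraicGeometry

namespace Literature.AlgebraicGeometry.HodgeTheory

open Literature.AlgebraicTopology.SingularHomology Literature.AlgebraicGeometry.Motives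

section HodgeTheory

/-! ### The seed predicate at an anchor -/

/-- **A Bloch seed for the class `q·hⁿ + w` on `P`** (Bloch 1972, hypothesis of Thm. (7.4) in the weakened form of Remark
(7.5): "there exist integers `a, b`, `a ≠ 0`, such that `a z₀ + b l₀^p` is the class of a subscheme `Z₀ ⊂ X₀` which is
semi-regular and a local complete intersection"). There are a scheme `Z`, a morphism `i : Z ⟶ P` and `q ∈ ℚ` with: `i` a
closed immersion and a REGULAR IMMERSION OF CODIMENSION `n` (local complete intersection of constant codimension `n`,
`IsRegularImmersionOfCodim`), `Z` INTEGRAL, every point of the image of codimension `≥ n` in `P`, `Z` BLOCH-SEMIREGULAR in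
`P` read as a `2n`-fold (`IsBlochSemiregular i (2n) n`: injectivity of `π : H¹(Z, 𝒩_{Z/P}) → H^{n+1}(P, Ω^{n-1}_P)`, rendered
as surjectivity of its Serre dual), and the class `q·hⁿ + w ∈ H^{2n}(P(ℂ); ℂ)` SUPPORTED on the image of `Z`
(`classesSupportedOn`; by purity it is then a multiple of `cl(Z)`). These are exactly the seed binders of the tree's
class-level Bloch theorem `BlochSemiregularSpread (2n) n`. PREDICATE, nothing asserted; a DESIGN INPUT (Bloch, Remark
(7.5), on the construction of semiregular representatives), for which no on-path lemma is claimed; see the module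
docstring for the seed classes this project has excluded. [cite: Bloch1972Semiregularity, Thm. (7.4) and Remark (7.5)]
[cite: BuchweitzFlenner2003, Thm. 5.2 and (8.1)] -/
def HasBlochSeedAt (n : ℕ) (P : Motives.AbelianVariety ℂ) (h : complexBetti P.X 2)
    (w : complexBetti P.X (2 * n)) : Prop :=
  ∃ (Z : Scheme.{0}) (i : Z ⟶ P.X.left) (q : ℚ),
    IsClosedImmersion i ∧ IsRegularImmersionOfCodim i n ∧ AlgebraicGeometry.IsIntegral Z ∧
    (∀ z ∈ Set.range i.base, (n : ℕ∞) ≤ Order.coheight z) ∧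
    IsBlochSemiregular i (2 * n) n ∧
    ((q : ℚ) : ℂ) • cupPowTwo h n + w ∈ classesSupportedOn P.X (Set.range i.base) (2 * n)

/-- Naturality of cup powers under `complexBetti.map` (restatement of `map_cupPowTwo` in the `complexBetti` spelling).
[cite: HatcherAT2002, §3.2 (naturality of the cup product)] -/
theorem complexBetti_map_cupPowTwo' {X' X : Motives.SchemeOver ℂ} (g : X' ⟶ X) (x : complexBetti X 2) (i : ℕ) :
    complexBetti.map g (2 * i) (cupPowTwo x i) = cupPowTwo (complexBetti.map g 2 x) i :=
  map_cupPowTwo _ x i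

/-! ### The bridge: Bloch's theorem (class level) ∧ a seed ⟹ the local clause -/

/-- **A Bloch seed at the anchor gives the local clause of the Weil ladder (every `d`).** Granting the tree's class-level
Bloch theorem in relative dimension `2n` and codimension `n` (`BlochSemiregularSpread (2n) n`: Bloch 1972 (7.4)/(7.5),
Buchweitz–Flenner 2003 Thm. 5.2, Voisin L7 Thm. 2.4 — REFEREED), a Bloch seed for `q·hⁿ + w` on `P` yields
`WeilAnchorLocalClause n d P h w`: along any smooth projective family `f : 𝒳 ⟶ S` of the clause (quasi-projective total
space, smooth quasi-projective base) with global classes `H` (fibrewise rational `(1,1)`) and `W` (fibrewise rational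
`(n,n)`) and a chart `e' : P ≅ 𝒳_{s₀}` with `e'^*H_{s₀} = h`, `e'^*W_{s₀} = w`, the global class `B := q·Hⁿ + W` is fibrewise
rational of type `(n,n)` (`IsRationalClass.cupPowTwo`, `isOfHodgeType_cupPowTwo`) and `e'^*B_{s₀} = q·hⁿ + w` is the seed's
supported class, so `BlochSemiregularSpread` gives an open `U ∋ s₀` with `B_s = q·H_sⁿ + W_s` algebraic for `s ∈ U`.
(The clause's hypotheses "fibres are abelian with an endomorphism of square `-d`" and "`S` irreducible" are not used:
Bloch's theorem needs neither.) [cite: Bloch1972Semiregularity, Thm. (7.4) and Remark (7.5)]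
[cite: BuchweitzFlenner2003, Thm. 5.2] [cite: VoisinTorino1994, Lecture 7, Thm. 2.4] -/
theorem weilAnchorLocalClause_of_blochSpread_of_blochSeedAt {n : ℕ} (d : ℕ)
    (hB : BlochSemiregularSpread (2 * n) n) {P : Motives.AbelianVariety ℂ} {h : complexBetti P.X 2}
    {w : complexBetti P.X (2 * n)} (hS : HasBlochSeedAt n P h w) : WeilAnchorLocalClause n d P h w := by
  obtain ⟨Z, i, q, hi, hreg, hint, hcoh, hsr, hsupp⟩ := hS
  intro 𝒳 S f hf h𝒳qp hSqp _ hsm _ H W hH hW s₀ e' hH₀ hW₀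
  -- the global class `B = q·Hⁿ + W` and its fibre restrictions
  set B : complexBetti 𝒳 (2 * n) := ((q : ℚ) : ℂ) • cupPowTwo H n + W with hBdef
  have hres : ∀ s : Motives.ComplexPoints S, complexBetti.map (Motives.fiberι f s) (2 * n) B =
      ((q : ℚ) : ℂ) • cupPowTwo (complexBetti.map (Motives.fiberι f s) 2 H) n +
        complexBetti.map (Motives.fiberι f s) (2 * n) W := by
    intro s
    rw [hBdef, map_add, map_smul, complexBetti_map_cupPowTwo']
  have hBrat : ∀ s : Motives.ComplexPoints S,
      IsRationalClass (complexBetti.map (Motives.fiberι f s) (2 * n) B) ∧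
        IsOfHodgeType (2 * n) (Motives.fiberOver f s) (2 * n) n n
          (complexBetti.map (Motives.fiberι f s) (2 * n) B) := by
    intro s
    rw [hres]
    exact ⟨(((hH s).1.cupPowTwo n).smul q).add (hW s).1,
      ((isOfHodgeType_cupPowTwo (hf.isSmoothProjective s) (hH s).2 n).smul _).add
        (hf.isSmoothProjective s) (hW s).2⟩
  -- the anchoring: `e'^* B_{s₀} = q·hⁿ + w`
  have hx : complexBetti.map e'.hom (2 * n) (complexBetti.map (Motives.fiberι f s₀) (2 * n) B) =
      ((q : ℚ) : ℂ) • cupPowTwo h n + w := by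
    rw [hres, map_add, map_smul, complexBetti_map_cupPowTwo', hH₀, hW₀]
  -- Bloch's theorem, class level
  obtain ⟨U, hUo, hs₀U, hU⟩ :=
    hB P.X Z i (((q : ℚ) : ℂ) • cupPowTwo h n + w) 𝒳 S f s₀ e' B hi hreg hint hcoh hsr hsupp hf h𝒳qp hSqp hsm
      hBrat hx
  refine ⟨U, q, hUo, hs₀U, fun s hs => ?_⟩
  rw [← hres]
  exact hU s hs

/-! ### Door A: a seed on one hyperbolic anchor -/

/-- **A hyperbolic Bloch seed in dimension `2n` for `K = ℚ(√-d)`**: a complex abelian `2n`-fold `P` with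
`ψ₀ ≫ ψ₀ = -(d • 𝟙 P)`, a projective embedding `e` and a rational `a ≠ 0` with `(P, ψ₀)` of HYPERBOLIC Weil type for
`h_K = d·e^*a + ψ₀^*e^*a`, a non-zero rational class `w` of the Weil plane `weilClassesOf P ψ₀ n d`, and a Bloch seed for
some `q·h_Kⁿ + w` on `P` (`HasBlochSeedAt`). Exactly the anchor binders of `HasLocallyAlgebraicWeilAnchor n d` with the
local clause replaced by the seed. PREDICATE, nothing asserted. [cite: Bloch1972Semiregularity, Remark (7.5)]
[cite: Markman2025SecantWeil, §1.5] -/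
def HasHyperbolicBlochSeed (n d : ℕ) : Prop :=
  ∃ (P : Motives.AbelianVariety ℂ) (ψ₀ : P ⟶ P) (e : Motives.ProjectiveEmbedding P.X)
    (a : complexBetti (Motives.projectiveSpace e.n ℂ) 2) (w : complexBetti P.X (2 * n)),
    P.dim = 2 * n ∧ ψ₀ ≫ ψ₀ = -(d • 𝟙 P) ∧ IsRationalClass a ∧ a ≠ 0 ∧
    Motives.IsHyperbolicWeilType P ψ₀ n
      ((d : ℂ) • complexBetti.map e.ι 2 a + complexBetti.map ψ₀.hom.hom.hom 2 (complexBetti.map e.ι 2 a)) ∧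
    w ∈ weilClassesOf P ψ₀ n d ∧ IsRationalClass w ∧ w ≠ 0 ∧
    HasBlochSeedAt n P
      ((d : ℂ) • complexBetti.map e.ι 2 a + complexBetti.map ψ₀.hom.hom.hom 2 (complexBetti.map e.ι 2 a)) w

/-- **Door A fed by a Bloch seed**: `BlochSemiregularSpread (2n) n ∧ HasHyperbolicBlochSeed n d ⟹
HasLocallyAlgebraicWeilAnchor n d` (the un-printed local input of the hyperbolic door, from a refereed deformation
theorem plus one seed). Summit-side consumers: `WeilTypeLadderLocalAnchor.lean` (reach ∧ LOCAL ⟹ every hyperbolic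
member; F0a at `n = 3`; R2₈ ⟹ all sixfolds at `n = 4`). [cite: Bloch1972Semiregularity, Thm. (7.4) and Remark (7.5)]
[cite: BuchweitzFlenner2003, Thm. 5.2] -/
theorem hasLocallyAlgebraicWeilAnchor_of_blochSpread_of_hyperbolicBlochSeed {n d : ℕ}
    (hB : BlochSemiregularSpread (2 * n) n) (hS : HasHyperbolicBlochSeed n d) :
    HasLocallyAlgebraicWeilAnchor n d := by
  obtain ⟨P, ψ₀, e, a, w, hP, hψ, ha, ha0, hhyp, hwW, hwrat, hw0, hseed⟩ := hS
  exact (hasLocallyAlgebraicWeilAnchor_iff n d).2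
    ⟨P, ψ₀, e, a, w, hP, hψ, ha, ha0, hhyp, hwW, hwrat, hw0,
      weilAnchorLocalClause_of_blochSpread_of_blochSeedAt d hB hseed⟩

/-! ### Door B′: seeds on Weil-similar anchors -/

/-- **Every `√-d`-Weil abelian `2n`-fold of Weil type `(n,n)` has a Weil-similar anchor with a Bloch seed** (PREDICATE,
nothing asserted): verbatim `HasSimilarLocallyAlgebraicWeilAnchors n d` with the local clause `WeilAnchorLocalClause n d P
h_P w` replaced by `HasBlochSeedAt n P h_P w`. [cite: Bloch1972Semiregularity, Remark (7.5)]
[cite: Schoen1998HodgeWeilAddendum, §10] -/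
def HasSimilarBlochSeeds (n d : ℕ) : Prop :=
  ∀ (A : Motives.AbelianVariety ℂ) (φ : A ⟶ A), A.dim = 2 * n → φ ≫ φ = -(d • 𝟙 A) →
    (∃ wA : complexBetti A.X (2 * n),
      wA ∈ weilClassesOf A φ n d ∧ wA ≠ 0 ∧ IsOfHodgeType (2 * n) A.X (2 * n) n n wA) →
    ∃ (eA : Motives.ProjectiveEmbedding A.X) (aA : complexBetti (Motives.projectiveSpace eA.n ℂ) 2)
      (P : Motives.AbelianVariety ℂ) (ψ₀ : P ⟶ P) (e : Motives.ProjectiveEmbedding P.X)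
      (a : complexBetti (Motives.projectiveSpace e.n ℂ) 2) (w : complexBetti P.X (2 * n)),
      IsRationalClass aA ∧ aA ≠ 0 ∧ P.dim = 2 * n ∧ ψ₀ ≫ ψ₀ = -(d • 𝟙 P) ∧ IsRationalClass a ∧ a ≠ 0 ∧
      w ∈ weilClassesOf P ψ₀ n d ∧ IsRationalClass w ∧ w ≠ 0 ∧ IsOfHodgeType (2 * n) P.X (2 * n) n n w ∧
      HasBlochSeedAt n P
        ((d : ℂ) • complexBetti.map e.ι 2 a + complexBetti.map ψ₀.hom.hom.hom 2 (complexBetti.map e.ι 2 a)) w ∧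
      Motives.IsWeilSimilar n P ψ₀
        ((d : ℂ) • complexBetti.map e.ι 2 a + complexBetti.map ψ₀.hom.hom.hom 2 (complexBetti.map e.ι 2 a))
        A φ
        ((d : ℂ) • complexBetti.map eA.ι 2 aA + complexBetti.map φ.hom.hom.hom 2 (complexBetti.map eA.ι 2 aA))

/-- The same predicate restricted to the NON-hyperbolic `(A, φ)` — the targets left over by the split-sixfold floor
(door B′ of the packet: `WeilTypeLadderSimilarReach.weilSixfolds_of_floor_of_reachSimilar_of_similarAnchorsAwayFromSplit`).
PREDICATE, nothing asserted. [cite: Bloch1972Semiregularity, Remark (7.5)] [cite: Schoen1998HodgeWeilAddendum, §10] -/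
def HasSimilarBlochSeedsAwayFromSplit (n d : ℕ) : Prop :=
  ∀ (A : Motives.AbelianVariety ℂ) (φ : A ⟶ A), A.dim = 2 * n → φ ≫ φ = -(d • 𝟙 A) →
    (∀ (e : Motives.ProjectiveEmbedding A.X) (a : complexBetti (Motives.projectiveSpace e.n ℂ) 2),
      IsRationalClass a → a ≠ 0 →
        ¬ Motives.IsHyperbolicWeilType A φ n
          ((d : ℂ) • complexBetti.map e.ι 2 a + complexBetti.map φ.hom.hom.hom 2 (complexBetti.map e.ι 2 a))) →
    (∃ wA : complexBetti A.X (2 * n),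
      wA ∈ weilClassesOf A φ n d ∧ wA ≠ 0 ∧ IsOfHodgeType (2 * n) A.X (2 * n) n n wA) →
    ∃ (eA : Motives.ProjectiveEmbedding A.X) (aA : complexBetti (Motives.projectiveSpace eA.n ℂ) 2)
      (P : Motives.AbelianVariety ℂ) (ψ₀ : P ⟶ P) (e : Motives.ProjectiveEmbedding P.X)
      (a : complexBetti (Motives.projectiveSpace e.n ℂ) 2) (w : complexBetti P.X (2 * n)),
      IsRationalClass aA ∧ aA ≠ 0 ∧ P.dim = 2 * n ∧ ψ₀ ≫ ψ₀ = -(d • 𝟙 P) ∧ IsRationalClass a ∧ a ≠ 0 ∧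
      w ∈ weilClassesOf P ψ₀ n d ∧ IsRationalClass w ∧ w ≠ 0 ∧ IsOfHodgeType (2 * n) P.X (2 * n) n n w ∧
      HasBlochSeedAt n P
        ((d : ℂ) • complexBetti.map e.ι 2 a + complexBetti.map ψ₀.hom.hom.hom 2 (complexBetti.map e.ι 2 a)) w ∧
      Motives.IsWeilSimilar n P ψ₀
        ((d : ℂ) • complexBetti.map e.ι 2 a + complexBetti.map ψ₀.hom.hom.hom 2 (complexBetti.map e.ι 2 a))
        A φ
        ((d : ℂ) • complexBetti.map eA.ι 2 aA + complexBetti.map φ.hom.hom.hom 2 (complexBetti.map eA.ι 2 aA))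

/-- Monotonicity: seeds for all targets give seeds for the non-hyperbolic targets. [folklore] -/
theorem hasSimilarBlochSeedsAwayFromSplit_of_all {n d : ℕ} (h : HasSimilarBlochSeeds n d) :
    HasSimilarBlochSeedsAwayFromSplit n d :=
  fun A φ hA hφ _ hWA ↦ h A φ hA hφ hWA

/-- **Door B′ fed by Bloch seeds (all targets)**: `BlochSemiregularSpread (2n) n ∧ HasSimilarBlochSeeds n d ⟹
HasSimilarLocallyAlgebraicWeilAnchors n d`. [cite: Bloch1972Semiregularity, Thm. (7.4) and Remark (7.5)]
[cite: BuchweitzFlenner2003, Thm. 5.2] -/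
theorem hasSimilarLocallyAlgebraicWeilAnchors_of_blochSpread_of_similarBlochSeeds {n d : ℕ}
    (hB : BlochSemiregularSpread (2 * n) n) (hS : HasSimilarBlochSeeds n d) :
    HasSimilarLocallyAlgebraicWeilAnchors n d := by
  intro A φ hA hφ hWA
  obtain ⟨eA, aA, P, ψ₀, e, a, w, haA, haA0, hP, hψ, ha, ha0, hwW, hwrat, hw0, hwH, hseed, hsim⟩ :=
    hS A φ hA hφ hWA
  exact ⟨eA, aA, P, ψ₀, e, a, w, haA, haA0, hP, hψ, ha, ha0, hwW, hwrat, hw0, hwH,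
    weilAnchorLocalClause_of_blochSpread_of_blochSeedAt d hB hseed, hsim⟩

/-- **Door B′ fed by Bloch seeds (non-hyperbolic targets)**: `BlochSemiregularSpread (2n) n ∧
HasSimilarBlochSeedsAwayFromSplit n d ⟹ HasSimilarLocallyAlgebraicWeilAnchorsAwayFromSplit n d`.
[cite: Bloch1972Semiregularity, Thm. (7.4) and Remark (7.5)] [cite: BuchweitzFlenner2003, Thm. 5.2] -/
theorem hasSimilarLocallyAlgebraicWeilAnchorsAwayFromSplit_of_blochSpread_of_similarBlochSeeds {n d : ℕ}
    (hB : BlochSemiregularSpread (2 * n) n) (hS : HasSimilarBlochSeedsAwayFromSplit n d) :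
    HasSimilarLocallyAlgebraicWeilAnchorsAwayFromSplit n d := by
  intro A φ hA hφ hnh hWA
  obtain ⟨eA, aA, P, ψ₀, e, a, w, haA, haA0, hP, hψ, ha, ha0, hwW, hwrat, hw0, hwH, hseed, hsim⟩ :=
    hS A φ hA hφ hnh hWA
  exact ⟨eA, aA, P, ψ₀, e, a, w, haA, haA0, hP, hψ, ha, ha0, hwW, hwrat, hw0, hwH,
    weilAnchorLocalClause_of_blochSpread_of_blochSeedAt d hB hseed, hsim⟩

/-! ### Sanity: the refereed input is a case of the Hodge conjecture in bidegree `(2n, n)` -/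

/-- **Upper bound of the engine hypothesis**: if every rational `(n,n)` class on every smooth projective `2n`-fold is
algebraic (the `(2n, n)` slice of the Hodge conjecture), `BlochSemiregularSpread (2n) n` holds — the tree's
`blochSemiregularSpread_of_forall_mem_algebraicClasses` at `(2n, n)`; so the FACT consumed by the bridges is on-path
(implied by HC), while the SEED predicate is a design input with no on-path lemma. [cite: Deligne2000, §1] -/
theorem blochSemiregularSpread_two_mul_of_forall_mem_algebraicClasses {n : ℕ}
    (h : ∀ ⦃X : Motives.SchemeOver ℂ⦄, Motives.IsSmoothProjective (2 * n) X → ∀ c : complexBetti X (2 * n),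
      IsRationalClass c → IsOfHodgeType (2 * n) X (2 * n) n n c → c ∈ algebraicClasses X n) :
    BlochSemiregularSpread (2 * n) n :=
  blochSemiregularSpread_of_forall_mem_algebraicClasses h

end HodgeTheory

end Literature.AlgebraicGeometry.HodgeTheory

end
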